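import Mathlib
import HarnessLib
import Literature.Probability.MarkovChains.TargetTimeSpectral
import Literature.Probability.MarkovChains.LazyChainSpectrum
import Literature.Probability.MarkovChains.ErgodicSumVariance
import Literature.Probability.MarkovChains.LpDistance

/-!
# Mixing from hitting: `d^{(∞)}(t) ≤ max_x E_π(τ_x)/t` for lazy reversible chains (Levin–Peres–Wilmer Thm 10.22) with eq. (10.37)

HONEST FRAMING: exact (Metropolis-corrected) sampling algorithms for lattice gauge theory; figures
of merit are autocorrelation/cost numbers at stated couplings and volumes; no continuum-physics claim.

Source: D. A. Levin, Y. Peres (with E. L. Wilmer), *Markov Chains and Mixing Times*, 2nd ed.,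
AMS 2017 [LevinPeres2017], §10.7.1 THEOREM 10.22 (eq. (10.33)) and its proof on pp. 143–144
("By the identity (10.38) in Proposition 10.26 and the monotonicity in Proposition 10.25 (ii) …
`π(x)E_π(τ_x) ≥ Σ_{k=1}^{t}[P^k(x,x) − π(x)] ≥ t[Pᵗ(x,x) − π(x)]` … Therefore, by (10.37),
`max_x E_π(τ_x)/t ≥ … ≥ max_{x,y} |Pᵗ(x,y)/π(y) − 1| = d^{(∞)}(t)`"), eq. (10.37) (p. 142).
Conventions of `TargetTimeSpectral.lean` (`E_a(τ_x)` via the fundamental matrix,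
`LevinPeres2017_prop_10_26_fundamental`), `SpectralRepresentation.lean` (Lemma 12.2, eq. (12.2):
`f_j = specFun hA j`, `λ_j = specVal hA j`), `LazyChainSpectrum.lean` (lazy ⇒ `λ_j ≥ 0`),
`ErgodicSumVariance.lean` (`|λ_j| ≤ 1`), `LpDistance.lean` (`relDensity = q_t(x,y) = Pᵗ(x,y)/π(y)`,
`lInfDist = d^{(∞)}(t)`) and `RandomTargetLemma.lean` (`IsHittingTimeSolution`).  Everything is
PROVED (0 named facts, 0 definitions).  LAZY means `P(x,x) ≥ ½` for all `x`.

* `stationaryHitting_eq_sum_specFun` — **`E_π(τ_x) = Σ_{j : λ_j ≠ 1} f_j(x)²/(1 − λ_j)`** for a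
  reversible irreducible chain (the spectral evaluation of `Z(x,x) − π(x)` from Prop. 10.26's
  fundamental-matrix form; the termwise content of the book's `Σ_{k≥0}[P^k(x,x) − π(x)]` computed
  with (12.2)) [cite: LevinPeres2017, §10.7 Prop. 10.26 eq. (10.38) with §12.1 eq. (12.2)];
* `mul_sub_le_stationaryHitting` — for a LAZY reversible irreducible chain and `t ≥ 1`:
  **`t·[Pᵗ(x,x) − π(x)] ≤ π(x)E_π(τ_x)`** (the two displayed inequalities of the proof of Thm 10.22;
  here termwise `tλᵗ ≤ Σ_{k<t} λ^k ≤ (1 − λ)⁻¹` for `0 ≤ λ < 1`, i.e. Prop. 10.25 (ii)'s monotonicity in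
  spectral form) [cite: LevinPeres2017, §10.7, proof of Thm 10.22];
* **eq. (10.37)** `LevinPeres2017_eq_10_37` — for a lazy reversible chain,
  `|q_t(x,y) − 1| ≤ √(q_t(x,x) − 1) √(q_t(y,y) − 1)` (Cauchy–Schwarz on
  `Σ_j f_j(x)f_j(y)λ_jᵗ` with `λ_jᵗ ≥ 0`; the book derives it from the augmented chain `K`,
  Exercise 10.19) [cite: LevinPeres2017, §10.7 eq. (10.37)];
* **THEOREM 10.22 (content of eq. (10.33))** `LevinPeres2017_thm_10_22`: for a lazy reversible
  irreducible chain, `d^{(∞)}(t) ≤ M/t` for every `t ≥ 1` whenever `E_π(τ_z) ≤ M` for all `z` — hence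
  `d^{(∞)}(t) ≤ ¼` as soon as `t ≥ 4 max_x E_π(τ_x)` (`LevinPeres2017_eq_10_33`), i.e.
  `t^{(∞)}_mix(¼) ≤ 4 max_x E_π(τ_x) + 1` [cite: LevinPeres2017, §10.7 Thm 10.22, eq. (10.33)].
  NOT CLAIMED: (10.34)–(10.35) (the passage to `t_mix` via `t^{(2)}_mix`), Remark 10.24, Prop. 10.28.

Context (cell pub-lqcd): "mixing time ≲ 4 × the worst expected hitting time from stationarity" is the
cleanest route from commute / hitting estimates (network resistance, `CommuteTimeIdentity.lean`) to
an ℓ^∞ mixing guarantee for a lazy reversible sampler.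
-/

namespace Literature.Probability.MarkovChains

open Finset Matrix

variable {X : Type*} [Fintype X] [DecidableEq X] {P : Matrix X X ℝ} {π : X → ℝ}

/-- **`E_π(τ_x) = Σ_{j : λ_j ≠ 1} f_j(x)²/(1 − λ_j)`**, multiplied through by `π(x)`:
`π(x) Σ_a π(a)E_a(τ_x) = π(x) Σ_{j : λ_j ≠ 1} f_j(x)² (1 − λ_j)⁻¹`. [cite: LevinPeres2017, §10.7
Prop. 10.26 eq. (10.38) with §12.1 eq. (12.2) (as combined in §12.5, proof of Lemma 12.17)] -/
theorem stationaryHitting_eq_sum_specFun (hP : IsRowStochastic P) (hπ : ∀ x, 0 < π x)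
    (hπ1 : ∑ x, π x = 1) (hDB : DetailedBalance π P) (hirr : IsIrreducible P)
    (hA : (symmMatrix π P).IsHermitian) {h : X → X → ℝ} (hh : IsHittingTimeSolution P h) (x : X) :
    ∑ a, π a * h a x =
      ∑ j ∈ univ.filter (fun j => specVal hA j ≠ 1), specFun hA j x ^ 2 * (1 - specVal hA j)⁻¹ := by
  have hst : IsStationary π P := hDB.isStationary hP.2
  have hπx := (hπ x).ne'
  have h26 := LevinPeres2017_prop_10_26_fundamental hP hπ hπ1 hst hirr hh x
  -- `Z(x,x) = π(x) [Σ_{λ_j = 1} f_j(x)² + Σ_{λ_j ≠ 1} f_j(x)²/(1 − λ_j)] = π(x)[1 + Σ_{λ_j ≠ 1} …]`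
  have hZ := fundamentalMatrix_apply_eq_sum hπ hA x x
  have hsplit : ∑ j, (fundamentalMatrix π P *ᵥ specFun hA j) x * specFun hA j x =
      1 + ∑ j ∈ univ.filter (fun j => specVal hA j ≠ 1),
        specFun hA j x ^ 2 * (1 - specVal hA j)⁻¹ := by
    rw [← sum_filter_add_sum_filter_not univ (fun j => specVal hA j ≠ 1), add_comm]
    congr 1
    · calc ∑ j ∈ univ.filter (fun j => ¬specVal hA j ≠ 1),
            (fundamentalMatrix π P *ᵥ specFun hA j) x * specFun hA j x
          = ∑ j ∈ univ.filter (fun j => specVal hA j = 1), specFun hA j x * specFun hA j x := by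
            refine Finset.sum_congr (by ext j; simp) fun j hj => ?_
            have hj' : specVal hA j = 1 := (mem_filter.1 hj).2
            rw [fundamentalMatrix_mulVec_specFun_of_eq_one hP hπ hπ1 hDB hirr hA hj' x]
        _ = 1 := sum_specFun_eigenvalue_one hπ hπ1 hP hDB hirr hA x x
    · refine sum_congr rfl fun j hj => ?_
      have hj' : specVal hA j ≠ 1 := (mem_filter.1 hj).2
      rw [fundamentalMatrix_mulVec_specFun hπ hπ1 hP hDB hirr hA hj', Pi.smul_apply, smul_eq_mul]
      ring
  rw [hsplit] at hZ
  -- `π(x)·LHS = Z(x,x) − π(x) = π(x)·RHS`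
  have key : π x * ∑ a, π a * h a x =
      π x * ∑ j ∈ univ.filter (fun j => specVal hA j ≠ 1),
        specFun hA j x ^ 2 * (1 - specVal hA j)⁻¹ := by
    rw [h26, hZ]; ring
  exact mul_left_cancel₀ hπx key

/-- For `0 ≤ λ < 1` and any `t`: `t·λᵗ ≤ Σ_{k<t} λ^k ≤ (1 − λ)⁻¹`. [cite: LevinPeres2017, §10.7,
proof of Thm 10.22 ("`Σ_{k=1}^{t}[P^k(x,x) − π(x)] ≥ t[Pᵗ(x,x) − π(x)]`", with Prop. 10.25 (ii))] -/
theorem mul_pow_le_inv_one_sub {l : ℝ} (h0 : 0 ≤ l) (h1 : l < 1) (t : ℕ) :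
    (t : ℝ) * l ^ t ≤ (1 - l)⁻¹ := by
  have hsum : (t : ℝ) * l ^ t ≤ ∑ k ∈ range t, l ^ k := by
    have : ∑ k ∈ range t, l ^ t ≤ ∑ k ∈ range t, l ^ k :=
      sum_le_sum fun k hk => pow_le_pow_of_le_one h0 h1.le (mem_range.1 hk).le
    simpa [sum_const, card_range] using this
  refine hsum.trans ?_
  have h1l : 0 < 1 - l := by linarith
  have hS : (∑ k ∈ range t, l ^ k) * (1 - l) = 1 - l ^ t := geom_sum_mul_neg l t
  have h2 : ∑ k ∈ range t, l ^ k ≤ 1 / (1 - l) := by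
    rw [le_div_iff₀ h1l, hS]
    linarith [pow_nonneg h0 t]
  simpa [one_div] using h2

/-- **`t·[Pᵗ(x,x) − π(x)] ≤ π(x) E_π(τ_x)`** for a LAZY reversible irreducible chain (`t ≥ 0`).
[cite: LevinPeres2017, §10.7, proof of Thm 10.22 (first display, via Prop. 10.26 and
Prop. 10.25 (ii))] -/
theorem mul_sub_le_stationaryHitting (hP : IsRowStochastic P) (hπ : ∀ x, 0 < π x)
    (hπ1 : ∑ x, π x = 1) (hDB : DetailedBalance π P) (hirr : IsIrreducible P)
    (hlazy : ∀ x, 1 / 2 ≤ P x x) {h : X → X → ℝ} (hh : IsHittingTimeSolution P h) (t : ℕ) (x : X) :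
    (t : ℝ) * (kernelAt P t x x - π x) ≤ π x * ∑ a, π a * h a x := by
  have hA := symmMatrix_isHermitian hπ hDB
  rw [stationaryHitting_eq_sum_specFun hP hπ hπ1 hDB hirr hA hh x,
    LevinPeres2017_eq_12_2 hπ hπ1 hP hDB hirr hA t x x, mul_left_comm]
  refine mul_le_mul_of_nonneg_left ?_ (hπ x).le
  rw [mul_sum]
  refine sum_le_sum fun j hj => ?_
  have hj' : specVal hA j ≠ 1 := (mem_filter.1 hj).2
  have h0 : 0 ≤ specVal hA j := specVal_nonneg_of_lazy hπ hA hP hlazy j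
  have h1 : specVal hA j < 1 := lt_of_le_of_ne (abs_le.1 (abs_specVal_le_one hπ hP hA hj')).2 hj'
  have hf : 0 ≤ specFun hA j x ^ 2 := sq_nonneg _
  calc (t : ℝ) * (specFun hA j x * specFun hA j x * specVal hA j ^ t)
      = specFun hA j x ^ 2 * ((t : ℝ) * specVal hA j ^ t) := by ring
    _ ≤ specFun hA j x ^ 2 * (1 - specVal hA j)⁻¹ :=
        mul_le_mul_of_nonneg_left (mul_pow_le_inv_one_sub h0 h1 t) hf

/-- **Eq. (12.2) for the density**: `q_t(u,v) − 1 = Σ_{j : λ_j ≠ 1} f_j(u) f_j(v) λ_jᵗ` (reversible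
irreducible chain, positive `π`). [cite: LevinPeres2017, §12.1 eq. (12.2); §4.7 (definition of `q_t`)] -/
theorem relDensity_sub_one_eq_sum (hP : IsRowStochastic P) (hπ : ∀ x, 0 < π x)
    (hπ1 : ∑ x, π x = 1) (hDB : DetailedBalance π P) (hirr : IsIrreducible P)
    (hA : (symmMatrix π P).IsHermitian) (t : ℕ) (u v : X) :
    relDensity P π t u v - 1 =
      ∑ j ∈ univ.filter (fun j => specVal hA j ≠ 1), specFun hA j u * specFun hA j v * specVal hA j ^ t := by
  have hv := (hπ v).ne'
  rw [relDensity_apply, div_sub_one hv, div_eq_iff hv, LevinPeres2017_eq_12_2 hπ hπ1 hP hDB hirr hA t u v,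
    mul_comm]

/-- **Eq. (10.37)** for a LAZY reversible irreducible chain:
`|q_t(x,y) − 1| ≤ √(q_t(x,x) − 1)·√(q_t(y,y) − 1)` (`q_t(x,y) = Pᵗ(x,y)/π(y)`).  Proof by
Cauchy–Schwarz on `q_t(x,y) − 1 = Σ_{λ_j ≠ 1} f_j(x)f_j(y)λ_jᵗ` (eq. (12.2)) with the weights
`λ_jᵗ ≥ 0`; the book obtains it from the augmented chain `K` (`K² = P`). [cite: LevinPeres2017, §10.7
eq. (10.37); Exercise 10.19] -/
theorem LevinPeres2017_eq_10_37 (hP : IsRowStochastic P) (hπ : ∀ x, 0 < π x)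
    (hπ1 : ∑ x, π x = 1) (hDB : DetailedBalance π P) (hirr : IsIrreducible P)
    (hlazy : ∀ x, 1 / 2 ≤ P x x) (t : ℕ) (x y : X) :
    |relDensity P π t x y - 1| ≤
      Real.sqrt (relDensity P π t x x - 1) * Real.sqrt (relDensity P π t y y - 1) := by
  have hA := symmMatrix_isHermitian hπ hDB
  set S := univ.filter (fun j => specVal hA j ≠ 1) with hS
  have hw : ∀ j, 0 ≤ specVal hA j ^ t :=
    fun j => pow_nonneg (specVal_nonneg_of_lazy hπ hA hP hlazy j) t
  have hq := relDensity_sub_one_eq_sum hP hπ hπ1 hDB hirr hA t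
  -- Cauchy–Schwarz with `a_j = f_j(x)√λᵗ`, `b_j = f_j(y)√λᵗ`
  have hcs := sum_mul_sq_le_sq_mul_sq S (fun j => specFun hA j x * Real.sqrt (specVal hA j ^ t))
    (fun j => specFun hA j y * Real.sqrt (specVal hA j ^ t))
  have hab : ∀ j, specFun hA j x * Real.sqrt (specVal hA j ^ t) *
      (specFun hA j y * Real.sqrt (specVal hA j ^ t)) =
      specFun hA j x * specFun hA j y * specVal hA j ^ t := by
    intro j
    have h2 := Real.mul_self_sqrt (hw j)
    calc specFun hA j x * Real.sqrt (specVal hA j ^ t) *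
          (specFun hA j y * Real.sqrt (specVal hA j ^ t))
        = specFun hA j x * specFun hA j y *
            (Real.sqrt (specVal hA j ^ t) * Real.sqrt (specVal hA j ^ t)) := by ring
      _ = specFun hA j x * specFun hA j y * specVal hA j ^ t := by rw [h2]
  have haa : ∀ u j, (specFun hA j u * Real.sqrt (specVal hA j ^ t)) ^ 2 =
      specFun hA j u * specFun hA j u * specVal hA j ^ t := by
    intro u j
    rw [mul_pow, Real.sq_sqrt (hw j)]
    ring
  simp_rw [hab, haa] at hcs
  rw [← hq x y, ← hq x x, ← hq y y] at hcs
  have hax : 0 ≤ relDensity P π t x x - 1 := by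
    rw [hq x x]; exact sum_nonneg fun j _ => mul_nonneg (mul_self_nonneg _) (hw j)
  rw [← Real.sqrt_mul hax, ← Real.sqrt_sq_eq_abs]
  exact Real.sqrt_le_sqrt hcs

/-- **THEOREM 10.22 (content of (10.33))**: for a LAZY reversible irreducible chain, if
`E_π(τ_z) ≤ M` for every `z`, then `d^{(∞)}(t) ≤ M/t` for every `t ≥ 1`
("`max_x E_π(τ_x)/t ≥ max_{x,y} |Pᵗ(x,y)/π(y) − 1| = d^{(∞)}(t)`"). [cite: LevinPeres2017, §10.7
Thm 10.22, proof (p. 144)] -/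
theorem LevinPeres2017_thm_10_22 (hP : IsRowStochastic P) (hπ : ∀ x, 0 < π x)
    (hπ1 : ∑ x, π x = 1) (hDB : DetailedBalance π P) (hirr : IsIrreducible P)
    (hlazy : ∀ x, 1 / 2 ≤ P x x) {h : X → X → ℝ} (hh : IsHittingTimeSolution P h) {M : ℝ}
    (hM : ∀ z, ∑ a, π a * h a z ≤ M) {t : ℕ} (ht : 1 ≤ t) :
    lInfDist P π t ≤ M / t := by
  have htpos : (0 : ℝ) < t := by exact_mod_cast ht
  obtain ⟨x₁, -, -⟩ := Finset.exists_ne_zero_of_sum_ne_zero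
    (s := (univ : Finset X)) (f := π) (by rw [hπ1]; exact one_ne_zero)
  haveI : Nonempty X := ⟨x₁⟩
  have hA := symmMatrix_isHermitian hπ hDB
  have hdiag0 : ∀ z, 0 ≤ relDensity P π t z z - 1 := fun z => by
    rw [relDensity_sub_one_eq_sum hP hπ hπ1 hDB hirr hA t z z]
    exact sum_nonneg fun j _ => mul_nonneg (mul_self_nonneg _)
      (pow_nonneg (specVal_nonneg_of_lazy hπ hA hP hlazy j) t)
  -- `q_t(z,z) − 1 ≤ E_π(τ_z)/t ≤ M/t`
  have hdiag : ∀ z, relDensity P π t z z - 1 ≤ M / t := by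
    intro z
    have hz := (hπ z).ne'
    have h1 := mul_sub_le_stationaryHitting hP hπ hπ1 hDB hirr hlazy hh t z
    have h2 : kernelAt P t z z - π z ≤ π z * M / t := by
      rw [le_div_iff₀ htpos]
      calc (kernelAt P t z z - π z) * t = (t : ℝ) * (kernelAt P t z z - π z) := mul_comm _ _
        _ ≤ π z * ∑ a, π a * h a z := h1
        _ ≤ π z * M := mul_le_mul_of_nonneg_left (hM z) (hπ z).le
    rw [relDensity_apply, div_sub_one hz, div_le_iff₀ (hπ z)]
    calc kernelAt P t z z - π z ≤ π z * M / t := h2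
      _ = M / t * π z := by ring
  have hMt : 0 ≤ M / t := (hdiag0 x₁).trans (hdiag x₁)
  have hxy : ∀ x y, |relDensity P π t x y - 1| ≤ M / t := fun x y =>
    calc |relDensity P π t x y - 1|
        ≤ Real.sqrt (relDensity P π t x x - 1) * Real.sqrt (relDensity P π t y y - 1) :=
          LevinPeres2017_eq_10_37 hP hπ hπ1 hDB hirr hlazy t x y
      _ ≤ Real.sqrt (M / t) * Real.sqrt (M / t) :=
          mul_le_mul (Real.sqrt_le_sqrt (hdiag x)) (Real.sqrt_le_sqrt (hdiag y))
            (Real.sqrt_nonneg _) (Real.sqrt_nonneg _)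
      _ = M / t := Real.mul_self_sqrt hMt
  unfold lInfDist
  exact ciSup_le fun x => ciSup_le fun y => hxy x y

/-- **Eq. (10.33)**: `d^{(∞)}(t) ≤ ¼` for every `t ≥ 4 max_x E_π(τ_x)` (lazy reversible irreducible
chain), i.e. `t^{(∞)}_mix(¼) ≤ 4 max_x E_π(τ_x) + 1`. [cite: LevinPeres2017, §10.7 Thm 10.22
eq. (10.33) ("Thus the left-hand side is less than `1/4` for `t ≥ max_x 4E_π(τ_x)`")] -/
theorem LevinPeres2017_eq_10_33 (hP : IsRowStochastic P) (hπ : ∀ x, 0 < π x)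
    (hπ1 : ∑ x, π x = 1) (hDB : DetailedBalance π P) (hirr : IsIrreducible P)
    (hlazy : ∀ x, 1 / 2 ≤ P x x) {h : X → X → ℝ} (hh : IsHittingTimeSolution P h) {M : ℝ}
    (hM : ∀ z, ∑ a, π a * h a z ≤ M) {t : ℕ} (ht : 1 ≤ t) (htM : 4 * M ≤ t) :
    lInfDist P π t ≤ 1 / 4 := by
  have htpos : (0 : ℝ) < t := by exact_mod_cast ht
  refine (LevinPeres2017_thm_10_22 hP hπ hπ1 hDB hirr hlazy hh hM ht).trans ?_
  rw [div_le_iff₀ htpos]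
  linarith

end Literature.Probability.MarkovChains
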